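import Literature.Geometry.ComplexAnalytic.PhamBrieskornCyclicNodeSphereTransversal
import HarnessLib

/-!
# The fibres of the ordinary double point `Σ zᵢ²` are transverse to the spheres: the Milnor fibre `{Σ zᵢ² = c}`
# touches the sphere `Σ |zᵢ|² = r²` only when `|c| = r²`

Layer `Literature/Geometry/ComplexAnalytic`; theorems only (no definition, no named fact). Written by the prover seat
`hodge-nonav-prover-Bx` (g13, cell `hodge-nonav`) for the Picard–Lefschetz programme of crux K1-B of
`Summits/HodgeConjecture/HodgeConjecture/Theses/SignSymmetricPowers.lean` (binder `picardLefschetz_nodalForms_uniform`,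
stmt-HodgeConjecture-19716): the `A₁` analogue, in ANY number of variables, of
`PhamBrieskornCyclicNodeSphereTransversal` (prover-Ax, the cyclic node `z₀² + z₁² + z₂^p`). It is the transversality input
of the shell constructions (vector fields tangent to the Milnor spheres; `CyclicNodePencilShellSubmersion` pattern) for the
geometric monodromy of a pencil of hypersurfaces near an ordinary double point, whose local equation is `Σ zᵢ²` in a
holomorphic Morse chart (`HolomorphicMorseLemma`, `OrdinaryDoublePointMorseChart`).

Milnor 1968, Cor. 2.9 / Lemma 4.3–4.6 / Thm. 4.8: the nearby fibres of an isolated singularity meet the small spheres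
transversally. For the quadric this is a one-line computation: if the differentials of `P = Σ zᵢ²` and of `Σ |zᵢ|²` are
dependent at `z`, `conj zᵢ = 2κ zᵢ` for all `i`, then `zᵢ² · 2κ = |zᵢ|²`, so `|P(z)| = Σ |zᵢ|²` (`|2κ| = 1`); hence on
the shell `r₀² ≤ Σ|zᵢ|²` every fibre `|P| < r₀²` — including the singular one — is transverse to the spheres.

* `quadric_tangency` — `conj zᵢ = κ · 2zᵢ` for all `i` ⟹ `|Σ zᵢ²| = Σ |zᵢ|²`;
* `hasFDerivAt_quadricLevelRadius` — the real derivative of `G = (Σ zᵢ², Σ |zᵢ|²) : ℂ^ι → ℂ × ℝ`;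
* **`surjective_fderiv_quadricLevelRadius`** — `dG_z` is onto whenever `z ≠ 0` and `|Σ zᵢ²| < Σ |zᵢ|²`;
  **`surjective_fderiv_quadricLevelRadius_of_shell`** — in particular at every `z` with `r₀² ≤ Σ|zᵢ|²` and `|Σ zᵢ²| < r₀²`.

## References

* [Milnor1968] J. Milnor, Singular Points of Complex Hypersurfaces, Ann. of Math. Studies 61 (1968), Cor. 2.9, Lemma 4.3,
  proof of Lemma 4.6 (Case 1), Thm. 4.8.
* [ArnoldGuseinzadeVarchenko2012] V. I. Arnold, S. M. Gusein-Zade, A. N. Varchenko, Singularities of Differentiable Maps,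
  Vol. 2 (2012 reprint), Part I §2.1 (the Milnor fibration: nonsingular fibres transverse to the sphere), §1.2 (the
  ordinary double point).
-/

noncomputable section

open Complex ContinuousMap Set Filter
open scoped ComplexConjugate BigOperators

namespace Literature.Geometry.ComplexAnalytic

namespace PhamBrieskorn

section Quadric

variable {ι : Type} [Fintype ι]

/-- If `conj w = c · w` then `w² · c = |w|²` (as a complex number). [cite: Milnor1968, §4 proof of Lemma 4.6] -/
theorem sq_mul_eq_norm_sq_of_conj_eq_mul {w c : ℂ} (h : conj w = c * w) :
    w ^ 2 * c = ((‖w‖ ^ 2 : ℝ) : ℂ) := by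
  calc w ^ 2 * c = w * (c * w) := by ring
    _ = w * conj w := by rw [← h]
    _ = ((‖w‖ ^ 2 : ℝ) : ℂ) := by rw [Complex.mul_conj, Complex.normSq_eq_norm_sq, Complex.ofReal_pow]

/-- If `conj w = c · w` with `w ≠ 0` then `|c| = 1`. [cite: Milnor1968, §4 proof of Lemma 4.6] -/
theorem norm_eq_one_of_conj_eq_mul' {w c : ℂ} (hw : w ≠ 0) (h : conj w = c * w) : ‖c‖ = 1 := by
  have hn := congrArg (fun u : ℂ => ‖u‖) h
  simp only [Complex.norm_conj, norm_mul] at hn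
  have hw' : 0 < ‖w‖ := norm_pos_iff.2 hw
  field_simp at hn
  linarith

/-- **The tangency dichotomy for the ordinary double point.** If the differential of `Σ|zᵢ|²` is a complex multiple
of that of `P = Σ zᵢ²` at `z` — `conj zᵢ = κ · 2 zᵢ` for all `i` — then `|P(z)| = Σ|zᵢ|²`: the fibre through `z` touches
the sphere through `z` only if `|P(z)| = r²`. [cite: Milnor1968, Cor. 2.9 and §4 proof of Lemma 4.6]
[cite: ArnoldGuseinzadeVarchenko2012, Part I §2.1] -/
theorem quadric_tangency {z : ι → ℂ} {κ : ℂ} (hκ : ∀ i, conj (z i) = κ * ((2 : ℂ) * z i)) :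
    ‖∑ i, z i ^ 2‖ = ∑ i, ‖z i‖ ^ 2 := by
  have hκ' : ∀ i, conj (z i) = (2 * κ) * z i := fun i => by rw [hκ i]; ring
  -- `(Σ zᵢ²) · 2κ = Σ |zᵢ|²`
  have hsum : (∑ i, z i ^ 2) * (2 * κ) = ((∑ i, ‖z i‖ ^ 2 : ℝ) : ℂ) := by
    rw [Finset.sum_mul, Complex.ofReal_sum]
    exact Finset.sum_congr rfl fun i _ => sq_mul_eq_norm_sq_of_conj_eq_mul (hκ' i)
  by_cases hz : z = 0
  · subst hz
    simp
  · obtain ⟨j, hj⟩ : ∃ j, z j ≠ 0 := Function.ne_iff.1 hz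
    have hk : ‖2 * κ‖ = 1 := norm_eq_one_of_conj_eq_mul' hj (hκ' j)
    have hn := congrArg (fun w : ℂ => ‖w‖) hsum
    simp only [norm_mul, hk, mul_one] at hn
    rw [hn, Complex.norm_real, Real.norm_eq_abs, abs_of_nonneg (by positivity)]

/-- **The real derivative of `G(z) = (Σ zᵢ², Σ |zᵢ|²) : ℂ^ι → ℂ × ℝ`** at `z` is
`v ↦ (Σ 2zᵢ vᵢ, 2 Re Σ conj zᵢ · vᵢ)`. [cite: Milnor1968, §4 Lemma 4.3] -/
theorem hasFDerivAt_quadricLevelRadius (z : ι → ℂ) :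
    ∃ L : (ι → ℂ) →L[ℝ] ℂ × ℝ,
      HasFDerivAt (fun z : ι → ℂ => ((∑ i, z i ^ 2 : ℂ), (∑ i, ‖z i‖ ^ 2 : ℝ))) L z ∧
      ∀ v, L v = (∑ i, ((2 : ℂ) * z i) * v i, 2 * (∑ i, conj (z i) * v i).re) := by
  have hP : HasFDerivAt (fun z : ι → ℂ => ∑ i, z i ^ 2)
      (∑ i : ι, ((2 : ℕ) • z i ^ (2 - 1)) • ContinuousLinearMap.proj (R := ℂ) (φ := fun _ : ι => ℂ) i) z :=
    HasFDerivAt.fun_sum fun i _ => (hasFDerivAt_apply (𝕜 := ℂ) i z).pow 2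
  have hR : HasFDerivAt (fun z : ι → ℂ => ∑ i, ‖z i‖ ^ 2)
      (∑ i : ι, (2 : ℕ) • (innerSL ℝ (z i)).comp (ContinuousLinearMap.proj (R := ℝ) (φ := fun _ : ι => ℂ) i)) z :=
    HasFDerivAt.fun_sum fun i _ => (hasFDerivAt_apply (𝕜 := ℝ) i z).norm_sq
  refine ⟨_, (hP.restrictScalars ℝ).prodMk hR, fun v => ?_⟩
  rw [ContinuousLinearMap.prod_apply, Prod.mk.injEq]
  constructor
  · rw [ContinuousLinearMap.coe_restrictScalars', sum_apply]
    refine Finset.sum_congr rfl fun i _ => ?_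
    rw [smul_apply, ContinuousLinearMap.proj_apply, smul_eq_mul, nsmul_eq_mul, pow_one, Nat.cast_ofNat]
  · rw [sum_apply, Complex.re_sum, Finset.mul_sum]
    refine Finset.sum_congr rfl fun i _ => ?_
    rw [smul_apply, ContinuousLinearMap.comp_apply, ContinuousLinearMap.proj_apply,
      innerSL_apply_apply, Complex.inner, nsmul_eq_mul, Nat.cast_ofNat, Complex.mul_re, Complex.mul_re,
      Complex.conj_re, Complex.conj_im]
    ring

/-- **The fibres of `Σ zᵢ²` are transverse to the spheres away from the tangency set**: if `z ≠ 0` and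
`|Σ zᵢ²| < Σ|zᵢ|²`, the real differential of `G = (Σ zᵢ², Σ|zᵢ|²) : ℂ^ι → ℂ × ℝ` at `z` is ONTO.
[cite: Milnor1968, Cor. 2.9 and §4 proof of Lemma 4.6 (Case 1)] [cite: ArnoldGuseinzadeVarchenko2012, Part I §2.1] -/
theorem surjective_fderiv_quadricLevelRadius {z : ι → ℂ} (hz : z ≠ 0)
    (hP : ‖∑ i, z i ^ 2‖ < ∑ i, ‖z i‖ ^ 2) :
    Function.Surjective (fderiv ℝ (fun z : ι → ℂ => ((∑ i, z i ^ 2 : ℂ), (∑ i, ‖z i‖ ^ 2 : ℝ))) z) := by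
  obtain ⟨L, hL, hLv⟩ := hasFDerivAt_quadricLevelRadius z
  rw [hL.fderiv]
  set a : ι → ℂ := fun i => (2 : ℂ) * z i with ha_def
  have ha : a ≠ 0 := by
    intro ha0
    apply hz
    funext i
    have hi : (2 : ℂ) * z i = 0 := congrFun ha0 i
    simpa using hi
  have hb : ∀ κ : ℂ, (fun i => conj (z i)) ≠ κ • a := by
    intro κ hκ
    have hκ' : ∀ i, conj (z i) = κ * ((2 : ℂ) * z i) := fun i => congrFun hκ i
    exact absurd (quadric_tangency hκ') hP.ne
  rintro ⟨x, t⟩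
  obtain ⟨v, hv₁, hv₂⟩ := exists_sum_mul_eq_and_re_sum_mul_eq ha hb x (t / 2)
  refine ⟨v, ?_⟩
  rw [hLv, Prod.mk.injEq]
  exact ⟨hv₁, by rw [hv₂]; ring⟩

/-- **Shell form.** For `0 < r₀`, at every `z` with `r₀² ≤ Σ|zᵢ|²` lying on a fibre `|Σ zᵢ²| < r₀²` — in particular on
the singular fibre `Σ zᵢ² = 0` — the differential of `(Σ zᵢ², Σ|zᵢ|²)` is onto: ALL these fibres cross the region
`Σ|zᵢ|² ≥ r₀²` transversally to the spheres (Milnor's `ε ≪ δ`, here `ε < r₀²`; no upper radius is needed for the quadric).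
[cite: Milnor1968, Cor. 2.9, Thm. 4.8] [cite: ArnoldGuseinzadeVarchenko2012, Part I §2.1] -/
theorem surjective_fderiv_quadricLevelRadius_of_shell {r₀ : ℝ} (hr₀ : 0 < r₀) {z : ι → ℂ}
    (hlow : r₀ ^ 2 ≤ ∑ i, ‖z i‖ ^ 2) (hP : ‖∑ i, z i ^ 2‖ < r₀ ^ 2) :
    Function.Surjective (fderiv ℝ (fun z : ι → ℂ => ((∑ i, z i ^ 2 : ℂ), (∑ i, ‖z i‖ ^ 2 : ℝ))) z) := by
  have hρpos : 0 < ∑ i, ‖z i‖ ^ 2 := lt_of_lt_of_le (by positivity) hlow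
  have hz : z ≠ 0 := by
    rintro rfl
    simp at hρpos
  exact surjective_fderiv_quadricLevelRadius hz (lt_of_lt_of_le hP hlow)

end Quadric

end PhamBrieskorn

end Literature.Geometry.ComplexAnalytic

end
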